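/-
Copyright (c) 2026 the pub-hodgecm-mathlib formalisation cell (harness21).  Prover seat hodgecm-mathlib-F0P3b-p01 (g25); offered to the E1 keeper ∕ dealer
F0P3a-p03 (g30) as row 40⁗ε (his 03:27:09Z residue of (d2a); sigsheet-first, rule 20): `dim r_P A = 1` from `dim r_P i_P(χ₁) = 2` and `r_P (i_P(χ₁) ∕ A) ≠ 0`.
-/
import Literature.NumberTheory.Automorphic.JacquetSelfExtensionOfInducedLine    -- ★ row 40⁗δ (this seat): `isSmooth_subrepresentation` (brings ★ `SmoothInduction`, `SmoothRepresentation`, Frobenius)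
import Literature.NumberTheory.Automorphic.JacquetNonvanishingOfEmbedding       -- ★ `Representation.nontrivial_coinvariants_of_injective_normalizedInd` (`r_P A ≠ 0` for `A ↪ i_P(σ)`)
import Literature.NumberTheory.Automorphic.JacquetModuleExactProofs              -- ★ `Representation.jacquetMap_injective` ∕ `jacquetMap_exact` ∕ `jacquetMap_surjective`
import HarnessLib

/-!
# Jacquet ranks along `0 → A → ρ → ρ ∕ A → 0`: `dim r_P A + dim r_P (ρ ∕ A) = dim r_P ρ`; a sub of `i_P(χ₁)` has `dim r_P A = 1` when `dim r_P i_P(χ₁) = 2`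
# and `r_P (i_P(χ₁) ∕ A) ≠ 0`

Generic (topological group `G`, parabolic triple `t = (P, M, N)` with `N` a union of compact open subgroups), ★ `JacquetModuleExactProofs` ∕
`JacquetNonvanishingOfEmbedding` ∕ `JacquetSelfExtensionOfInducedLine` + Mathlib, THEOREMS ONLY (no `def`, no instance, no named fact).  Namespace
`Literature.NumberTheory.Automorphic`.  Cell `pub/hodgecm-mathlib`, crux H413 = `stmt-HodgeConjecture-24833` (`--supports` lane): the input `h1 : dim r_P A = 1` of ★ (δ)
`exists_line_letters_of_finrank_eq_one` (hence of the (b) block of ★ row 40″) in the SENTENCE's own letters `(A, hAinv)` (a `Submodule` with its invariance, NOT the bundled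
`Subrepresentation` type of ★ `JacquetRankStrictMono` §3), from two inputs: `dim r_P i_P(χ₁) = 2` (★ named fact `U3PrincipalSeriesJacquetFiltration` at the CM datum,
[Casselman1995, Lemma 7.1.1 (a)]) and «`r_P (i_P(χ₁) ∕ A) ≠ 0`» (the quotient constituent is not cuspidal, [Casselman1995, Cor. 6.3.9]; [Keys1984, §3] for `π²(ξ)`).
Seat F0P3b-p01 (g25).

THE MATHEMATICS.  ★ exactness of `r_P` ([BernsteinZelevinsky1977, Prop. 1.9 (a)]; [Casselman1995, Prop. 3.2.3]) on `0 → A ↪ ρ ↠ ρ ∕ A → 0` (`ρ` smooth, `N` a limit of compact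
opens) gives `dim r_P A + dim r_P(ρ ∕ A) = dim r_P ρ` (rank–nullity for `r_P` of the quotient map); for `ρ = i_P(χ₁)` and `A ≠ ⊥`, `r_P A ≠ 0` (★ Frobenius,
`nontrivial_coinvariants_of_injective_normalizedInd`), so `dim r_P ρ = 2` and `r_P(ρ ∕ A) ≠ 0` force `dim r_P A = 1`.
* §1 `jacquetMap_subtype_injective`, `jacquetMap_subtype_mkQ_exact`, `jacquetMap_mkQ_surjective`, **`finrank_coinvariants_subrepresentation_add_quotient`**.
* §2 `nontrivial_coinvariants_subrepresentation_normalizedInd`, **`finrank_coinvariants_subrepresentation_normalizedInd_eq_one`** (= ★ (δ)'s `h1`).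
[cite: BernsteinZelevinsky1977, Prop. 1.9 (a); Prop. 1.9 (b)] [cite: Casselman1995, Prop. 3.2.3; Cor. 6.3.9; Lemma 7.1.1 (a) p. 67; Prop. 7.1.3 p. 67] [cite: Keys1984, §3 pp. 118–119]
HONEST LABEL: count-neutral generic layer; HC_CM is proved only modulo the printed citations of that programme until its rung 0 closes.

## References
* [BernsteinZelevinsky1977] I. N. Bernstein, A. V. Zelevinsky, *Induced representations of reductive p-adic groups I*, Ann. Sci. ÉNS 10 (1977), Prop. 1.9 (a), (b).
* [Casselman1995] W. Casselman, *Introduction to the theory of admissible representations of p-adic reductive groups* (1995), Prop. 3.2.3, Cor. 6.3.9, §7.1.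
* [Keys1984] D. Keys, *Principal series representations of special unitary groups over local fields*, Compositio Math. 51 (1984), §3 pp. 118–119.
-/

set_option autoImplicit false

noncomputable section

namespace Literature.NumberTheory.Automorphic

open _root_.Representation

/-! ## §1 `dim r_P A + dim r_P (ρ ∕ A) = dim r_P ρ` -/

section Count

variable {k : Type*} [Field k] [CharZero k] {G : Type*} [Group G] [TopologicalSpace G] [IsTopologicalGroup G] (t : ParabolicTriple G)
  (hN : IsLimitOfCompactOpen ↥t.N) {V : Type*} [AddCommGroup V] [Module k V] (ρ : Representation k G V) (hρ : ρ.IsSmooth)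
  (A : Submodule k V) (hAinv : ∀ g, A ≤ A.comap (ρ g))

include hN hρ in
/-- **`r_P(A ↪ ρ)` is injective** (★ left exactness `jacquetMap_injective`; `ρ` smooth, `N` a limit of compact opens). [cite: BernsteinZelevinsky1977, Prop. 1.9 (a)]
[cite: Casselman1995, Prop. 3.2.3] -/
theorem jacquetMap_subtype_injective :
    Function.Injective (jacquetMap t (⟨A.subtype, fun _ => LinearMap.ext fun _ => rfl⟩ : (ρ.subrepresentation A hAinv).IntertwiningMap ρ)) :=
  jacquetMap_injective t hN hρ _ Subtype.val_injective

omit [CharZero k] [TopologicalSpace G] [IsTopologicalGroup G] in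
/-- **`r_P A → r_P ρ → r_P(ρ ∕ A)` is exact** (★ `jacquetMap_exact`). [cite: BernsteinZelevinsky1977, Prop. 1.9 (a)] [cite: Casselman1995, Prop. 3.2.3] -/
theorem jacquetMap_subtype_mkQ_exact :
    Function.Exact (jacquetMap t (⟨A.subtype, fun _ => LinearMap.ext fun _ => rfl⟩ : (ρ.subrepresentation A hAinv).IntertwiningMap ρ))
      (jacquetMap t (⟨A.mkQ, fun _ => LinearMap.ext fun _ => rfl⟩ : ρ.IntertwiningMap (ρ.quotient A hAinv))) := by
  refine jacquetMap_exact t _ _ (fun v => ?_) (Submodule.mkQ_surjective A)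
  change A.mkQ v = 0 ↔ v ∈ Set.range A.subtype
  rw [Submodule.mkQ_apply, Submodule.Quotient.mk_eq_zero]
  constructor
  · intro hv
    exact ⟨⟨v, hv⟩, rfl⟩
  · rintro ⟨w, rfl⟩
    exact w.2

omit [CharZero k] [TopologicalSpace G] [IsTopologicalGroup G] in
/-- **`r_P ρ → r_P(ρ ∕ A)` is surjective** (★ `jacquetMap_surjective`). [cite: BernsteinZelevinsky1977, Prop. 1.9 (a)] -/
theorem jacquetMap_mkQ_surjective :
    Function.Surjective (jacquetMap t (⟨A.mkQ, fun _ => LinearMap.ext fun _ => rfl⟩ : ρ.IntertwiningMap (ρ.quotient A hAinv))) :=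
  jacquetMap_surjective t _ (Submodule.mkQ_surjective A)

include hN hρ in
/-- **`dim r_P A + dim r_P(ρ ∕ A) = dim r_P ρ`** for a smooth `ρ` with finite-dimensional Jacquet module: rank–nullity for `r_P(ρ ↠ ρ ∕ A)`, whose kernel is the
(injective) image of `r_P A` by exactness. [cite: BernsteinZelevinsky1977, Prop. 1.9 (a)] [cite: Casselman1995, Prop. 3.2.3; Lemma 7.1.1 (a) p. 67] -/
theorem finrank_coinvariants_subrepresentation_add_quotient [FiniteDimensional k (t.restrict ρ).Coinvariants] :
    Module.finrank k (t.restrict (ρ.subrepresentation A hAinv)).Coinvariants + Module.finrank k (t.restrict (ρ.quotient A hAinv)).Coinvariants =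
      Module.finrank k (t.restrict ρ).Coinvariants := by
  set ι := jacquetMap t (⟨A.subtype, fun _ => LinearMap.ext fun _ => rfl⟩ : (ρ.subrepresentation A hAinv).IntertwiningMap ρ) with hιdef
  set q := jacquetMap t (⟨A.mkQ, fun _ => LinearMap.ext fun _ => rfl⟩ : ρ.IntertwiningMap (ρ.quotient A hAinv)) with hqdef
  have hι : Function.Injective ι := jacquetMap_subtype_injective t hN ρ hρ A hAinv
  have hex : Function.Exact ι q := jacquetMap_subtype_mkQ_exact t ρ A hAinv
  have hq : Function.Surjective q := jacquetMap_mkQ_surjective t ρ A hAinv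
  have hker : LinearMap.ker q.toLinearMap = LinearMap.range ι.toLinearMap := LinearMap.exact_iff.1 hex
  have h1 := LinearMap.finrank_range_add_finrank_ker q.toLinearMap
  rw [LinearMap.range_eq_top.2 hq, finrank_top, hker, LinearMap.finrank_range_of_inj hι] at h1
  omega

end Count

/-! ## §2 A sub of `i_P(χ₁)`: `dim r_P A = 1` from `dim r_P i_P(χ₁) = 2` and `r_P(i_P(χ₁) ∕ A) ≠ 0` -/

section InducedSub

variable {G : Type*} [Group G] [TopologicalSpace G] [IsTopologicalGroup G] (t : ParabolicTriple G) [LocallyCompactSpace ↥t.P]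
  (hN : IsLimitOfCompactOpen ↥t.N) (hδ : ∀ (n : G) (hn : n ∈ t.N), deltaChar t.P ⟨n, t.N_le hn⟩ = 1)
  {W : Type*} [AddCommGroup W] [Module ℂ W] (σ : Representation ℂ ↥t.M W)
  (A : Submodule ℂ (SmoothInd t.P (Representation.twist (σ.comp t.proj) (rootDeltaChar t.P))))
  (hAinv : ∀ g, A ≤ A.comap (Representation.normalizedInd t σ g)) (hA : A ≠ ⊥)

include hδ hA in
/-- **`r_P A ≠ 0` for an invariant `A ≤ i_P(σ)`, `A ≠ ⊥`** (★ `nontrivial_coinvariants_of_injective_normalizedInd` on the inclusion; `A` is smooth by ★ (δ)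
`isSmooth_subrepresentation` + ★ `isSmooth_smoothInd`). [cite: BernsteinZelevinsky1977, Prop. 1.9 (b)] [cite: Casselman1995, Cor. 6.3.9] -/
theorem nontrivial_coinvariants_subrepresentation_normalizedInd :
    Nontrivial (t.restrict ((Representation.normalizedInd t σ).subrepresentation A hAinv)).Coinvariants := by
  haveI : Nontrivial ↥A := Submodule.nontrivial_iff_ne_bot.2 hA
  exact nontrivial_coinvariants_of_injective_normalizedInd t _ hδ (isSmooth_subrepresentation _ A hAinv (isSmooth_smoothInd _ _)) σ
    ⟨A.subtype, fun _ => LinearMap.ext fun _ => rfl⟩ Subtype.val_injective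

include hN hδ hA in
/-- **`dim r_P A = 1`** for an invariant `A ≤ i_P(σ)`, `A ≠ ⊥`, when `dim r_P i_P(σ) = 2` and `r_P(i_P(σ) ∕ A) ≠ 0`: by §1 `dim r_P A = 2 − dim r_P(i_P(σ) ∕ A) ≤ 1`, and
`r_P A ≠ 0`.  This is the input `h1` of ★ (δ) `exists_line_letters_of_finrank_eq_one` (hence of the (b) block of ★ row 40″) in the SENTENCE's letters.
[cite: Casselman1995, Lemma 7.1.1 (a) p. 67; Prop. 7.1.3 p. 67; Cor. 6.3.9] [cite: Keys1984, §3 pp. 118–119] -/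
theorem finrank_coinvariants_subrepresentation_normalizedInd_eq_one
    [FiniteDimensional ℂ (t.restrict (Representation.normalizedInd t σ)).Coinvariants]
    (h2 : Module.finrank ℂ (t.restrict (Representation.normalizedInd t σ)).Coinvariants = 2)
    (hQ : Nontrivial (t.restrict ((Representation.normalizedInd t σ).quotient A hAinv)).Coinvariants) :
    Module.finrank ℂ (t.restrict ((Representation.normalizedInd t σ).subrepresentation A hAinv)).Coinvariants = 1 := by
  have hsum := finrank_coinvariants_subrepresentation_add_quotient t hN (Representation.normalizedInd t σ) (isSmooth_smoothInd _ _) A hAinv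
  rw [h2] at hsum
  -- the two summands are finite-dimensional (sub ∕ quotient of the finite-dimensional `r_P i_P(σ)`) and non-zero
  haveI : FiniteDimensional ℂ (t.restrict ((Representation.normalizedInd t σ).subrepresentation A hAinv)).Coinvariants :=
    Module.Finite.of_injective _ (jacquetMap_subtype_injective t hN (Representation.normalizedInd t σ) (isSmooth_smoothInd _ _) A hAinv)
  haveI : FiniteDimensional ℂ (t.restrict ((Representation.normalizedInd t σ).quotient A hAinv)).Coinvariants :=
    Module.Finite.of_surjective _ (jacquetMap_mkQ_surjective t (Representation.normalizedInd t σ) A hAinv)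
  haveI := nontrivial_coinvariants_subrepresentation_normalizedInd t hδ σ A hAinv hA
  have hApos : 0 < Module.finrank ℂ (t.restrict ((Representation.normalizedInd t σ).subrepresentation A hAinv)).Coinvariants := Module.finrank_pos
  have hQpos : 0 < Module.finrank ℂ (t.restrict ((Representation.normalizedInd t σ).quotient A hAinv)).Coinvariants := Module.finrank_pos
  omega

end InducedSub

end Literature.NumberTheory.Automorphic

end
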